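import Mathlib
import HarnessLib

/-!
# Householder reflections: `SO(d)` acts transitively on the unit sphere of `ℝ^d` (`d ≥ 2`)

HONEST FRAMING: exact (Metropolis-corrected) sampling algorithms for lattice gauge theory;
figures of merit are autocorrelation/cost numbers at stated couplings and volumes; no
continuum-physics claim.

Venture `LatticeQCDFlow` (cell pub-lqcd), topic `Exactness`, FANOUT row 9 (eng-latcore, the
engine `latflow.core`).  NEW WORK of the cell (elementary matrix algebra over Mathlib: `vecMulVec`,
the matrix determinant lemma `Matrix.det_one_sub_mul_comm`).  Nothing is cited as a fact.  Printed
counterpart, NAMED ONLY: Householder 1958 (J. ACM 5); Cartan–Dieudonné.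

Purpose: the linear-algebra half of the CP(N−1) "sphere dictionary" (`SphereOrbitLaw.lean`): the
`SO(d)`-orbit law of a unit vector under Haar is the uniform probability on the sphere, which needs
that every unit vector is reached — transitivity — proved here by composing two reflections.

## What is proved (`m` a finite index type, vectors `m → ℝ`, `v ⬝ᵥ v` the squared length)

* `householder v = 1 − (2/(v·v)) v vᵀ`: symmetric (`householder_transpose`), an involution
  (`householder_mul_self`, `v ≠ 0`), orthogonal (`householder_mem_orthogonalGroup`), determinant
  `−1` (`det_householder`); `householder_mulVec` (`x ↦ x − (2 v·x/v·v) v`), fixes `v⊥`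
  (`householder_mulVec_of_orthogonal`), and **maps `e` to `s`** for unit `e ≠ s` with `v = e − s`
  (`householder_mulVec_eq`).
* `exists_orthogonal_ne_zero` — for `card m ≥ 2` every vector has a non-zero orthogonal vector.
* **`exists_specialOrthogonal_mulVec_eq`** — for `card m ≥ 2` and unit vectors `e, s` there is
  `O ∈ SO(d)` (`Matrix.specialOrthogonalGroup m ℝ`) with `O e = s` (two reflections: `e ↦ s`, then a
  reflection in a hyperplane containing `s` to restore the determinant).

NOT CLAIMED: `d = 1` (false: `SO(1)` is trivial and the sphere has two points); Cartan–Dieudonné in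
general.
-/

namespace Summit.Ventures.LatticeQCDFlow.Exactness

open Matrix

variable {m : Type*} [Fintype m] [DecidableEq m]

/-! ## §1 Householder reflections -/

/-- The Householder reflection through the hyperplane orthogonal to `v`:
`H_v = 1 − (2/(v·v)) v vᵀ`. -/
noncomputable def householder (v : m → ℝ) : Matrix m m ℝ :=
  1 - (2 / (v ⬝ᵥ v)) • vecMulVec v v

/-- `H_v` is symmetric. -/
theorem householder_transpose (v : m → ℝ) : (householder v)ᵀ = householder v := by
  simp [householder, transpose_sub, transpose_smul, transpose_vecMulVec]

omit [DecidableEq m] in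
/-- A non-zero real vector has positive squared length. -/
theorem dotProduct_self_ne_zero {v : m → ℝ} (hv : v ≠ 0) : v ⬝ᵥ v ≠ 0 :=
  fun h => hv (dotProduct_self_eq_zero.1 h)

/-- `H_v` is an involution (`v ≠ 0`). -/
theorem householder_mul_self {v : m → ℝ} (hv : v ≠ 0) : householder v * householder v = 1 := by
  have hvv : v ⬝ᵥ v ≠ 0 := dotProduct_self_ne_zero hv
  set c : ℝ := 2 / (v ⬝ᵥ v) with hc
  have hcc : c * c * (v ⬝ᵥ v) = c + c := by rw [hc]; field_simp; ring
  simp only [householder, ← hc]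
  rw [sub_mul, one_mul, mul_sub, mul_one, Matrix.smul_mul, Matrix.mul_smul, vecMulVec_mul_vecMulVec,
    vecMulVec_smul, smul_smul, smul_smul, hcc, add_smul]
  abel

/-- `H_v x = x − (2 (v·x)/(v·v)) v`. -/
theorem householder_mulVec (v x : m → ℝ) :
    householder v *ᵥ x = x - (2 / (v ⬝ᵥ v) * (v ⬝ᵥ x)) • v := by
  rw [householder, sub_mulVec, one_mulVec, smul_mulVec, vecMulVec_mulVec, op_smul_eq_smul, smul_smul]

/-- `H_v` fixes the hyperplane orthogonal to `v`. -/
theorem householder_mulVec_of_orthogonal {v x : m → ℝ} (h : v ⬝ᵥ x = 0) : householder v *ᵥ x = x := by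
  rw [householder_mulVec, h, mul_zero, zero_smul, sub_zero]

/-- **A reflection maps `e` to `s`**: for unit vectors `e ≠ s`, `H_{e−s} e = s`. -/
theorem householder_mulVec_eq {e s : m → ℝ} (he : e ⬝ᵥ e = 1) (hs : s ⬝ᵥ s = 1) (hes : e ≠ s) :
    householder (e - s) *ᵥ e = s := by
  have hv : e - s ≠ 0 := sub_ne_zero.2 hes
  have hvv : (e - s) ⬝ᵥ (e - s) ≠ 0 := dotProduct_self_ne_zero hv
  have h1 : (e - s) ⬝ᵥ (e - s) = 2 * (1 - e ⬝ᵥ s) := by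
    rw [sub_dotProduct, dotProduct_sub, dotProduct_sub, he, hs, dotProduct_comm s e]; ring
  have h2 : (e - s) ⬝ᵥ e = 1 - e ⬝ᵥ s := by
    rw [sub_dotProduct, he, dotProduct_comm s e]
  have hne : 1 - e ⬝ᵥ s ≠ 0 := by
    intro h0; apply hvv; rw [h1, h0, mul_zero]
  rw [householder_mulVec, h1, h2]
  have : 2 / (2 * (1 - e ⬝ᵥ s)) * (1 - e ⬝ᵥ s) = 1 := by field_simp
  rw [this, one_smul, sub_sub_cancel]

/-- `H_v` is orthogonal (`v ≠ 0`). -/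
theorem householder_mem_orthogonalGroup {v : m → ℝ} (hv : v ≠ 0) :
    householder v ∈ Matrix.orthogonalGroup m ℝ := by
  rw [Matrix.mem_orthogonalGroup_iff', householder_transpose]
  exact householder_mul_self hv

/-- `det H_v = −1` (`v ≠ 0`): the matrix determinant lemma. -/
theorem det_householder {v : m → ℝ} (hv : v ≠ 0) : (householder v).det = -1 := by
  have hvv : v ⬝ᵥ v ≠ 0 := dotProduct_self_ne_zero hv
  rw [householder, ← smul_vecMulVec, vecMulVec_eq Unit, det_one_sub_mul_comm, det_unique, Matrix.sub_apply,
    Matrix.one_apply_eq, replicateRow_mul_replicateCol_apply, dotProduct_smul, smul_eq_mul,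
    div_mul_cancel₀ _ hvv]
  norm_num

/-! ## §2 Transitivity of `SO(d)` on the unit sphere, `d ≥ 2` -/

/-- In dimension `≥ 2` every vector has a non-zero orthogonal vector. -/
theorem exists_orthogonal_ne_zero (h2 : 2 ≤ Fintype.card m) (s : m → ℝ) :
    ∃ w : m → ℝ, w ≠ 0 ∧ w ⬝ᵥ s = 0 := by
  obtain ⟨i, j, hij⟩ := Fintype.exists_pair_of_one_lt_card (lt_of_lt_of_le one_lt_two h2)
  by_cases h0 : s i = 0 ∧ s j = 0
  · refine ⟨Pi.single i 1, ?_, ?_⟩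
    · intro h; have := congrFun h i; simp at this
    · rw [single_dotProduct, h0.1, mul_zero]
  · refine ⟨Pi.single i (s j) - Pi.single j (s i), ?_, ?_⟩
    · intro h
      apply h0
      have hi := congrFun h i
      have hj := congrFun h j
      simp [hij, Ne.symm hij] at hi hj
      exact ⟨by linarith, hi⟩
    · rw [sub_dotProduct, single_dotProduct, single_dotProduct]; ring

/-- **`SO(d)` is transitive on the unit sphere (`d ≥ 2`)**: for unit vectors `e, s` there is a special
orthogonal matrix with `O e = s` (two Householder reflections). -/
theorem exists_specialOrthogonal_mulVec_eq (h2 : 2 ≤ Fintype.card m) {e s : m → ℝ} (he : e ⬝ᵥ e = 1)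
    (hs : s ⬝ᵥ s = 1) :
    ∃ O : Matrix m m ℝ, O ∈ Matrix.specialOrthogonalGroup m ℝ ∧ O *ᵥ e = s := by
  by_cases hes : e = s
  · exact ⟨1, Submonoid.one_mem _, by rw [one_mulVec, hes]⟩
  obtain ⟨w, hw0, hws⟩ := exists_orthogonal_ne_zero h2 s
  have hv : e - s ≠ 0 := sub_ne_zero.2 hes
  refine ⟨householder w * householder (e - s), ?_, ?_⟩
  · rw [Matrix.mem_specialOrthogonalGroup_iff]
    refine ⟨?_, ?_⟩
    · exact Submonoid.mul_mem _ (householder_mem_orthogonalGroup hw0) (householder_mem_orthogonalGroup hv)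
    · rw [det_mul, det_householder hw0, det_householder hv]; norm_num
  · rw [← mulVec_mulVec, householder_mulVec_eq he hs hes, householder_mulVec_of_orthogonal hws]

end Summit.Ventures.LatticeQCDFlow.Exactness
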